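import Literature.NumberTheory.Automorphic.AdeleAddCharLocalNontrivial    -- `exists_adeleAddCharAt_ne_one`, `adeleAddCharAt_eq_of_sub_mem` (via `AdelicAdditiveCharacter`)
import Literature.NumberTheory.Automorphic.GaloisActionPlaces             -- `galAdicCompletionMap`, `valued_galAdicCompletionMap`, `HeightOneSpectrum.valuation_algEquiv_smul`
import Literature.NumberTheory.Automorphic.UnitaryGroupSplitPlace         -- `algEquiv_mul_self_eq_one` (quadratic extensions)
import Mathlib.NumberTheory.NumberField.CMField
import HarnessLib

/-!
# Galois equivariance of the local components of Tate's character; a `σ`-fixed element on which `ψ_w` is non-trivial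

Topic `NumberTheory/Automorphic`; namespace `Literature.NumberTheory.Automorphic`.  KERNEL mathematics only (theorems; no
definition, no named fact, no `sorry`).

For a number field `E`, an automorphism `σ` of `E` (over some subfield `F`) and finite places `w`, `w' = σ w`, the transport
`σ_w : E_w → E_{σ w}` of completions (`galAdicCompletionMap`) intertwines the local components of Tate's character
`ψ_E = e^{2πiΛ}`, `Λ = Σ_𝔭 λ_p ∘ Tr_{E_𝔭/ℚ_p}` ([Tate1950] §2.2, §4.1; in the tree `adeleAddChar`, `adeleAddCharAt`):

* `adeleAddCharAt_galAdicCompletionMap` — **`ψ_{σ w}(σ_w x) = ψ_w(x)`** for every `x ∈ E_w`.  Proof by the tree's global approximation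
  formula `adeleAddCharAt_eq_of_sub_mem` (`ψ_w(x) = exp(2πi Tr_{E/ℚ}(k))` whenever `k ∈ E` is `w`-adically congruent to `x` modulo `𝒪_w` and
  integral at the other finite places): `σ k` does the same job for `σ_w x` at `σ w` (`σ_w` preserves valuations, `v_{σ u}(σ k) = v_u(k)`), and
  `Tr_{E/ℚ}(σ k) = Tr_{E/ℚ}(k)`.  This is the invariance `Λ(σ x) = Λ(x)` of Tate's `Λ` under automorphisms ([Tate1950] §2.2: `λ_𝔭 = λ_p ∘ Tr`,
  and the trace is Galois-invariant), equivalently `ψ_{σ𝔭}(σ x) = ψ_𝔭(x)` [WeilBNT1967, Ch. IV §2, Cor. 3 of Th. 3 with Ch. VIII §4].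
* `exists_galAdicCompletionMap_eq_self_and_adeleAddCharAt_ne_one` — for an INVOLUTION `σ` (`σ² = 1`) fixing `w` there is a `σ_w`-FIXED `a ∈ E_w` with
  `ψ_w(a) ≠ 1`: with `u` such that `ψ_w(u) ≠ 1` (★ `exists_adeleAddCharAt_ne_one`), `ψ_w(u + σ_w u) = ψ_w(u)²` by equivariance, so `a = u + σ_w u` works
  unless `ψ_w(u) = −1`, in which case `a = u∕2 + σ_w(u∕2)` does (`ψ_w(u∕2)² = −1`).
* `IsCMField.exists_fixed_adeleAddCharAt_ne_one` — the CM case (`σ =` complex conjugation of a CM field `L`, `w` a place fixed by it): the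
  non-degeneracy input «`ψ_w` is non-trivial on the fixed field `L⁺_v ⊂ L_w`» of the Lie-algebra Fourier analysis on `𝔲(σ_w, H_w)` (whose trace
  form `tr(XY)` is `σ_w`-fixed), asked for by the pub-hodgecm-mathlib K2-E3 road (refuter K2E3-r01 FIX-1 on `subsig_K2E3UNilpotentFourierRegular`,
  2026-09-04).
[Tate1950, §2.2, §4.1] [WeilBNT1967, Ch. IV §2] [CasselsFrohlichANT1967, Ch. VII §1.1 (conjugate places), Ch. XV (Tate)].

## References
* [Tate1950] J. Tate, *Fourier analysis in number fields and Hecke's zeta-functions* (1950), in Cassels–Fröhlich, *Algebraic Number Theory* (1967),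
  Ch. XV, §2.2, §4.1.
* [WeilBNT1967] A. Weil, *Basic Number Theory*, Grundlehren 144 (1967), Ch. IV §2.
* [CasselsFrohlichANT1967] J. W. S. Cassels, A. Fröhlich (eds.), *Algebraic Number Theory* (1967), Ch. VII §1.1.
-/

set_option autoImplicit false

noncomputable section

open NumberField IsDedekindDomain

namespace Literature.NumberTheory.Automorphic

section General

variable (F : Type*) [Field F] [CharZero F] {E : Type} [Field E] [NumberField E] [Algebra F E]

/-- **Global approximation at one place**: every `x ∈ E_w` is congruent modulo `𝒪_w` to a global `k ∈ E` which is integral at all other finite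
places (`𝔸_E = E + (E_∞ × ∏ 𝒪_u)`, ★ `exists_isFiniteIntegral_sub_algebraMap`, read at the adele `(…, 0, x, 0, …)`).
[cite: CasselsFrohlichANT1967, Ch. XV (Tate), Lemma 4.1.3] -/
theorem exists_sub_mem_adicCompletionIntegers_and_forall (w : HeightOneSpectrum (𝓞 E)) (x : w.adicCompletion E) :
    ∃ k : E, x - (k : w.adicCompletion E) ∈ w.adicCompletionIntegers E ∧
      ∀ u : HeightOneSpectrum (𝓞 E), u ≠ w → (k : u.adicCompletion E) ∈ u.adicCompletionIntegers E := by
  obtain ⟨k, hk⟩ := exists_isFiniteIntegral_sub_algebraMap E (adeleSingleHom E w x)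
  refine ⟨k, ?_, fun u hu => ?_⟩
  · have := hk w
    change (adeleSingleHom E w x).2 w - (algebraMap E (AdeleRing (𝓞 E) E) k).2 w ∈ _ at this
    rwa [adeleSingleHom_apply_snd, finiteAdeleSingleHom_apply_self, AdeleRing.algebraMap_snd] at this
  · have := hk u
    change (adeleSingleHom E w x).2 u - (algebraMap E (AdeleRing (𝓞 E) E) k).2 u ∈ _ at this
    rw [adeleSingleHom_apply_snd, finiteAdeleSingleHom_apply_of_ne E w _ hu, zero_sub, AdeleRing.algebraMap_snd] at this
    simpa using neg_mem this

/-- `Tr_{E/ℚ}(σ k) = Tr_{E/ℚ}(k)` for an automorphism `σ` of `E` over a subfield `F` (Mathlib `Algebra.trace_eq_of_algEquiv` after restricting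
scalars to `ℚ`). [folklore] -/
private theorem trace_rat_algEquiv (σ : E ≃ₐ[F] E) (k : E) : Algebra.trace ℚ E (σ k) = Algebra.trace ℚ E k := by
  have h := Algebra.trace_eq_of_algEquiv (σ.restrictScalars ℚ) k
  rwa [AlgEquiv.restrictScalars_apply] at h

/-- **Galois equivariance of the local components of Tate's character: `ψ_{σ w}(σ_w x) = ψ_w(x)`** (`σ ∈ Aut(E/F)`, `w` a finite place of `E`,
`σ_w = galAdicCompletionMap σ : E_w → E_{σ w}`).  Global approximation: if `k ∈ E` is `≡ x (mod 𝒪_w)` and integral elsewhere then `σ k` is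
`≡ σ_w x (mod 𝒪_{σ w})` and integral elsewhere, and `ψ_w(x) = exp(2πi Tr(k)) = exp(2πi Tr(σ k)) = ψ_{σ w}(σ_w x)` (★ `adeleAddCharAt_eq_of_sub_mem`).
[cite: Tate1950, §2.2] [cite: CasselsFrohlichANT1967, Ch. VII §1.1] -/
theorem adeleAddCharAt_galAdicCompletionMap (σ : E ≃ₐ[F] E) {w w' : HeightOneSpectrum (𝓞 E)} (h : σ • w = w') (x : w.adicCompletion E) :
    adeleAddCharAt E w' (galAdicCompletionMap σ h x) = adeleAddCharAt E w x := by
  obtain ⟨k, hkw, hku⟩ := exists_sub_mem_adicCompletionIntegers_and_forall w x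
  -- `σ k` approximates `σ_w x` at `w'`
  have h1 : galAdicCompletionMap σ h x - ((σ k : E) : w'.adicCompletion E) ∈ w'.adicCompletionIntegers E := by
    rw [← galAdicCompletionMap_coe_algEquiv F σ h k, ← map_sub]
    exact (galAdicCompletionMap_mem_adicCompletionIntegers_iff E σ h _).2 hkw
  -- and is integral at every other place `u` (as `k` is at `σ⁻¹ u ≠ w`)
  have h2 : ∀ u : HeightOneSpectrum (𝓞 E), u ≠ w' → ((σ k : E) : u.adicCompletion E) ∈ u.adicCompletionIntegers E := by
    intro u hu
    have hu' : σ⁻¹ • u ≠ w := by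
      intro h'
      apply hu
      rw [← h, ← h', smul_inv_smul]
    have hk' := hku (σ⁻¹ • u) hu'
    rw [HeightOneSpectrum.mem_adicCompletionIntegers, HeightOneSpectrum.valuedAdicCompletion_eq_valuation'] at hk' ⊢
    have hval := HeightOneSpectrum.valuation_algEquiv_smul F σ (σ⁻¹ • u) k
    rw [smul_inv_smul] at hval
    rwa [hval]
  rw [adeleAddCharAt_eq_of_sub_mem E w hkw hku, adeleAddCharAt_eq_of_sub_mem E w' h1 h2, trace_rat_algEquiv F σ k]

/-- **A `σ_w`-fixed element on which `ψ_w` is non-trivial**, for an involution `σ ∈ Aut(E/F)` (`σ² = 1`) and a finite place `w` with `σ w = w`: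
`∃ a ∈ E_w`, `σ_w a = a`, `ψ_w(a) ≠ 1`.  With `ψ_w(u) ≠ 1` (★ `exists_adeleAddCharAt_ne_one`) and equivariance, `ψ_w(u + σ_w u) = ψ_w(u)²`; take
`a = u + σ_w u`, or `a = u∕2 + σ_w(u∕2)` when `ψ_w(u) = −1`. [cite: Tate1950, §2.2] [cite: WeilBNT1967, Ch. IV §2] -/
theorem exists_galAdicCompletionMap_eq_self_and_adeleAddCharAt_ne_one (σ : E ≃ₐ[F] E) (hσ : σ * σ = 1) {w : HeightOneSpectrum (𝓞 E)}
    (hw : σ • w = w) :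
    ∃ a : w.adicCompletion E, galAdicCompletionMap σ hw a = a ∧ adeleAddCharAt E w a ≠ 1 := by
  obtain ⟨u, hu⟩ := exists_adeleAddCharAt_ne_one E w
  -- `σ_w` is an involution and `u + σ_w u` is fixed, with `ψ_w(u + σ_w u) = ψ_w(u)²`
  have hinv : ∀ y : w.adicCompletion E, galAdicCompletionMap σ hw (galAdicCompletionMap σ hw y) = y := fun y => by
    rw [galAdicCompletionMap_galAdicCompletionMap, galAdicCompletionMap_congr_left E hσ _ (one_smul _ w), galAdicCompletionMap_one]
  have hfix : ∀ y : w.adicCompletion E, galAdicCompletionMap σ hw (y + galAdicCompletionMap σ hw y) = y + galAdicCompletionMap σ hw y :=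
    fun y => by rw [map_add, hinv, add_comm]
  have hsq : ∀ y : w.adicCompletion E, adeleAddCharAt E w (y + galAdicCompletionMap σ hw y) = adeleAddCharAt E w y * adeleAddCharAt E w y :=
    fun y => by rw [AddChar.map_add_eq_mul, adeleAddCharAt_galAdicCompletionMap F σ hw]
  by_cases h1 : adeleAddCharAt E w u * adeleAddCharAt E w u = 1
  · -- `ψ_w(u) = -1`: use `u/2`
    have h2 : (2 : w.adicCompletion E) ≠ 0 := by
      rw [show (2 : w.adicCompletion E) = algebraMap E (w.adicCompletion E) 2 from (map_ofNat _ 2).symm]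
      exact (map_ne_zero _).2 two_ne_zero
    haveI : NeZero (2 : w.adicCompletion E) := ⟨h2⟩
    set y : w.adicCompletion E := u / 2 with hy
    have hyy : y + y = u := by rw [hy, add_halves]
    refine ⟨y + galAdicCompletionMap σ hw y, hfix y, fun habs => hu ?_⟩
    rw [hsq] at habs
    -- `ψ(u) = ψ(y)² = 1`
    rw [← hyy, AddChar.map_add_eq_mul, habs]
  · exact ⟨u + galAdicCompletionMap σ hw u, hfix u, fun habs => h1 (by rw [← hsq, habs])⟩

end General

/-- **CM case**: for a CM field `L` with complex conjugation `c` and a finite place `w` of `L` fixed by `c` (a non-split place), there is a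
`σ_w`-fixed `a ∈ L_w` — i.e. `a` in the closure `L⁺_v` of the maximal totally real subfield — with `ψ_w(a) ≠ 1` (`c² = 1`: ★ `algEquiv_mul_self_eq_one`).
The non-degeneracy input for Fourier analysis with the kernel `ψ_w(tr(XY))` on the `σ_w`-skew-hermitian matrices. [cite: Tate1950, §2.2] [cite: WeilBNT1967, Ch. IV §2] -/
theorem IsCMField.exists_fixed_adeleAddCharAt_ne_one (L : Type) [Field L] [NumberField L] [IsCMField L] {w : HeightOneSpectrum (𝓞 L)}
    (hw : IsCMField.complexConj L • w = w) :
    ∃ a : w.adicCompletion L, galAdicCompletionMap (L := L) (IsCMField.complexConj L) hw a = a ∧ adeleAddCharAt L w a ≠ 1 :=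
  exists_galAdicCompletionMap_eq_self_and_adeleAddCharAt_ne_one ↥(maximalRealSubfield L) (IsCMField.complexConj L)
    (algEquiv_mul_self_eq_one ↥(maximalRealSubfield L) (IsCMField.complexConj_ne_one L)) hw

end Literature.NumberTheory.Automorphic

end
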